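import Mathlib.Topology.Algebra.OpenSubgroup
import Mathlib.Topology.Algebra.ClopenNhdofOne
import Mathlib.Topology.Algebra.Group.ClosedSubgroup
import Mathlib.Topology.Algebra.Group.Quotient
import Mathlib.Topology.Algebra.InfiniteSum.Basic
import Mathlib.GroupTheory.FiniteAbelian.Basic
import Mathlib.GroupTheory.Index
import Mathlib.GroupTheory.OrderOfElement
import Mathlib.Data.Nat.Factorization.Basic
import Mathlib.Data.Int.GCD
import Literature.AlgebraicGeometry.Frobenioids.ProfiniteUnits
import HarnessLib

/-!
# Frobenioids I, Definition 2.8: proofs of the group-theoretic statements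

Mochizuki, *The geometry of Frobenioids I*, Kyushu J. Math. **62** (2008), Definition 2.8,
kurims pp. 52–53 [cite: MochizukiFrdI2008, Def. 2.8 p.52].  `ProfiniteUnits.lean` records the
group theory of Def. 2.8 as named statements; this file PROVES them (additive companion, no
signature change):

* `TfgProfiniteTopologyUnique.of_commGroup` — Def. 2.8 (i) "[uniquely determined]": on an *abelian* group
  two topologically-finitely-generated profinite group topologies coincide (every finite-index
  subgroup is open, and open subgroups form a neighbourhood basis of `1`).  The named statement
  `TfgProfiniteTopologyUnique M` is phrased for any group `M`; the general (non-abelian) case is the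
  Nikolov–Segal theorem and is NOT proved here — Def. 2.8 only uses the abelian case `O^×(A)`,
  so this is recorded as the abelian special case (`.of_commGroup`), and discharges the
  abelian-scope named statement `TfgProfiniteAbelianTopologyUnique` (`…_holds`, appended).
* the basic toolkit on open subgroups of a profinite abelian group used by the decomposition
  `M = ∏_l M[l]` and the `ζ`-th power maps (Def. 2.8 (ii), (iii)), proved in the sequel files.

No new definitions (theorems only).
-/

namespace Literature.AlgebraicGeometry.Frobenioids

open _root_.Topology Filter
open scoped Pointwise

universe u

section Toolkit

variable {M : Type u} [CommGroup M] [TopologicalSpace M]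

namespace IsTfgProfinite

/-- An open subgroup of a (tfg) profinite abelian group has finite index (compactness).
[cite: MochizukiFrdI2008, Def. 2.8(i) p.52] -/
theorem finiteIndex_openSubgroup (h : IsTfgProfinite M) (U : OpenSubgroup M) :
    (U : Subgroup M).FiniteIndex := by
  haveI := h.isTopologicalGroup
  haveI := h.compactSpace
  exact Subgroup.finiteIndex_of_finite_quotient

/-- The index of an open subgroup of a (tfg) profinite abelian group is non-zero.
[cite: MochizukiFrdI2008, Def. 2.8(i) p.52] -/
theorem index_ne_zero (h : IsTfgProfinite M) (U : OpenSubgroup M) :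
    (U : Subgroup M).index ≠ 0 := by
  haveI := h.finiteIndex_openSubgroup U
  exact Subgroup.FiniteIndex.index_ne_zero

/-- `x ^ [M : U] ∈ U` for an open subgroup `U`. [cite: MochizukiFrdI2008, Def. 2.8(i) p.52] -/
theorem pow_index_mem (U : OpenSubgroup M) (x : M) :
    x ^ (U : Subgroup M).index ∈ U :=
  (U : Subgroup M).pow_index_mem x

/-- Open subgroups form a neighbourhood basis of `1` in a profinite group.
[cite: MochizukiFrdI2008, Def. 2.8(i) p.52] -/
theorem exists_openSubgroup_subset (h : IsTfgProfinite M) {W : Set M} (hW : W ∈ 𝓝 (1 : M)) :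
    ∃ U : OpenSubgroup M, (U : Set M) ⊆ W := by
  haveI := h.isTopologicalGroup
  haveI := h.compactSpace
  haveI := h.totallyDisconnectedSpace
  obtain ⟨V, hVW, hV, h1⟩ := mem_nhds_iff.mp hW
  obtain ⟨H, hH⟩ := ProfiniteGrp.exist_openNormalSubgroup_sub_open_nhds_of_one hV h1
  exact ⟨H.toOpenSubgroup, hH.trans hVW⟩

/-- Translates `x • U` of open subgroups form a neighbourhood basis of `x` in a profinite group.
[cite: MochizukiFrdI2008, Def. 2.8(i) p.52] -/
theorem exists_openSubgroup_mul_subset (h : IsTfgProfinite M) {x : M} {W : Set M}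
    (hW : W ∈ 𝓝 x) : ∃ U : OpenSubgroup M, ∀ u ∈ U, x * u ∈ W := by
  haveI := h.isTopologicalGroup
  have hc : Continuous fun u : M => x * u := continuous_const.mul continuous_id
  have : (fun u : M => x * u) ⁻¹' W ∈ 𝓝 (1 : M) :=
    hc.continuousAt.preimage_mem_nhds (by simpa using hW)
  obtain ⟨U, hU⟩ := h.exists_openSubgroup_subset this
  exact ⟨U, fun u hu => hU hu⟩

/-- In a profinite group an element lying in every open subgroup is trivial (Hausdorff).
[cite: MochizukiFrdI2008, Def. 2.8(i) p.52] -/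
theorem eq_one_of_forall_mem (h : IsTfgProfinite M) {z : M} (hz : ∀ U : OpenSubgroup M, z ∈ U) :
    z = 1 := by
  haveI := h.t2Space
  by_contra hne
  obtain ⟨U, hU⟩ := h.exists_openSubgroup_subset (compl_singleton_mem_nhds (Ne.symm hne))
  exact hU (hz U) rfl

/-- Two elements congruent modulo every open subgroup of a profinite group are equal.
[cite: MochizukiFrdI2008, Def. 2.8(i) p.52] -/
theorem eq_of_forall_inv_mul_mem (h : IsTfgProfinite M) {x y : M}
    (hxy : ∀ U : OpenSubgroup M, x⁻¹ * y ∈ U) : x = y :=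
  inv_mul_eq_one.mp (h.eq_one_of_forall_mem hxy)

/-- In a topologically finitely generated compact Hausdorff abelian group the subgroup of `n`-th
powers (`n ≠ 0`) is open: it is closed (a continuous image of a compact space) and of finite index
(the dense finitely generated subgroup has finitely many cosets modulo `n`-th powers).
[cite: MochizukiFrdI2008, Def. 2.8(i) p.52] -/
theorem isOpen_range_powMonoidHom (h : IsTfgProfinite M) {n : ℕ} (hn : n ≠ 0) :
    IsOpen ((powMonoidHom n : M →* M).range : Set M) := by
  classical
  haveI := h.isTopologicalGroup
  haveI := h.compactSpace
  haveI := h.t2Space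
  set K : Subgroup M := (powMonoidHom n : M →* M).range with hK
  have hKc : IsClosed (K : Set M) := by
    have hrange : (K : Set M) = Set.range fun x : M => x ^ n := by
      ext y
      simp [hK]
    rw [hrange]
    exact (isCompact_range (continuous_pow n)).isClosed
  obtain ⟨S, hS⟩ := h.exists_finset_dense
  set H : Subgroup M := Subgroup.closure (S : Set M) with hH
  haveI : ((powMonoidHom n : H →* H).range).FiniteIndex :=
    Subgroup.finiteIndex_range_powMonoidHom_of_fg H hn
  have hle : (powMonoidHom n : H →* H).range ≤ K.comap H.subtype := by
    rintro _ ⟨y, rfl⟩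
    refine ⟨(y : M), ?_⟩
    simp
  let φ : H ⧸ (powMonoidHom n : H →* H).range →* M ⧸ K := QuotientGroup.map _ K H.subtype hle
  have hfin : (QuotientGroup.mk '' (H : Set M) : Set (M ⧸ K)).Finite := by
    refine (Set.finite_range φ).subset ?_
    rintro _ ⟨x, hx, rfl⟩
    exact ⟨QuotientGroup.mk (⟨x, hx⟩ : H), rfl⟩
  haveI : T1Space (M ⧸ K) := QuotientGroup.t1Space_iff.mpr hKc
  have hdense : Dense (QuotientGroup.mk '' (H : Set M) : Set (M ⧸ K)) := by
    rw [QuotientGroup.dense_image_mk]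
    exact hS.mono (Set.subset_mul_left _ K.one_mem)
  have huniv : (QuotientGroup.mk '' (H : Set M) : Set (M ⧸ K)) = Set.univ := by
    rw [← hdense.closure_eq, hfin.isClosed.closure_eq]
  haveI : Finite (M ⧸ K) := Set.finite_univ_iff.mp (huniv ▸ hfin)
  haveI : K.FiniteIndex := Subgroup.finiteIndex_of_finite_quotient
  exact K.isOpen_of_isClosed_of_finiteIndex hKc

/-- In a topologically finitely generated compact Hausdorff abelian group every finite-index
subgroup is open. [cite: MochizukiFrdI2008, Def. 2.8(i) p.52] -/
theorem isOpen_of_finiteIndex (h : IsTfgProfinite M) (L : Subgroup M) [L.FiniteIndex] :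
    IsOpen (L : Set M) := by
  haveI := h.isTopologicalGroup
  refine Subgroup.isOpen_mono ?_
    (h.isOpen_range_powMonoidHom (n := L.index) Subgroup.FiniteIndex.index_ne_zero)
  rintro _ ⟨x, rfl⟩
  exact L.pow_index_mem x

/-- Neighbourhoods of `1` in a tfg profinite abelian group are exactly the sets containing a
finite-index subgroup — a description that does not mention the topology.
[cite: MochizukiFrdI2008, Def. 2.8(i) p.52] -/
theorem mem_nhds_one_iff (h : IsTfgProfinite M) (W : Set M) :
    W ∈ 𝓝 (1 : M) ↔ ∃ L : Subgroup M, L.FiniteIndex ∧ (L : Set M) ⊆ W := by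
  constructor
  · intro hW
    obtain ⟨U, hU⟩ := h.exists_openSubgroup_subset hW
    exact ⟨U, h.finiteIndex_openSubgroup U, hU⟩
  · rintro ⟨L, hL, hLW⟩
    exact Filter.mem_of_superset ((h.isOpen_of_finiteIndex L).mem_nhds L.one_mem) hLW

/-- `x ^ a ≡ x ^ b (mod U)` whenever `a ≡ b (mod [M : U])`, for an open subgroup `U`.
[cite: MochizukiFrdI2008, Def. 2.8(ii) p.52] -/
theorem mk_pow_eq_mk_pow_of_modEq (U : OpenSubgroup M) (x : M) {a b : ℕ}
    (hab : a ≡ b [MOD (U : Subgroup M).index]) :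
    (QuotientGroup.mk (x ^ a) : M ⧸ (U : Subgroup M)) = QuotientGroup.mk (x ^ b) := by
  rw [QuotientGroup.mk_pow, QuotientGroup.mk_pow]
  refine pow_eq_pow_iff_modEq.mpr (hab.of_dvd (orderOf_dvd_of_pow_eq_one ?_))
  rw [← QuotientGroup.mk_pow, QuotientGroup.eq_one_iff]
  exact pow_index_mem U x

/-- `x ^ a ∈ U` whenever `[M : U] ∣ a`, for an open subgroup `U`.
[cite: MochizukiFrdI2008, Def. 2.8(ii) p.52] -/
theorem pow_mem_of_index_dvd (U : OpenSubgroup M) (x : M) {a : ℕ}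
    (ha : (U : Subgroup M).index ∣ a) : x ^ a ∈ U := by
  obtain ⟨k, rfl⟩ := ha
  rw [pow_mul]
  exact U.pow_mem (pow_index_mem U x) k

/-- `x ^ gcd(m,n) ∈ U` whenever `x ^ m ∈ U` and `x ^ n ∈ U` (Bezout).
[cite: MochizukiFrdI2008, Def. 2.8(ii) p.52] -/
theorem pow_gcd_mem (U : OpenSubgroup M) {x : M} {m n : ℕ} (hm : x ^ m ∈ U) (hn : x ^ n ∈ U) :
    x ^ m.gcd n ∈ U := by
  rw [← OpenSubgroup.mem_toSubgroup, ← QuotientGroup.eq_one_iff, QuotientGroup.mk_pow] at hm hn ⊢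
  exact pow_gcd_eq_one.mpr ⟨hm, hn⟩

/-- **Existence of compatible profinite powers.**  Let `E : ℕ → ℕ` be a compatible system of
exponents (`E m ≡ E n (mod n)` whenever `n ∣ m`, i.e. an element of `Ẑ = lim ℤ/nℤ`).  Then for
every `x` in a profinite abelian group there is an element `y` — "`x ^ E`" — with
`y ≡ x ^ E([M:U]) (mod U)` for every open subgroup `U` (compactness: the closed cosets
`x ^ E([M:U]) · U` have the finite intersection property).  This is the mechanism behind the
decomposition `M = ∏_l M[l]` and the `ζ`-th power maps of Def. 2.8 (ii), (iii).
[cite: MochizukiFrdI2008, Def. 2.8(ii) p.52] -/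
theorem exists_compatible_elem (h : IsTfgProfinite M) {E : ℕ → ℕ}
    (hE : ∀ n m : ℕ, n ≠ 0 → m ≠ 0 → n ∣ m → E m ≡ E n [MOD n]) (x : M) :
    ∃ y : M, ∀ U : OpenSubgroup M, (x ^ E (U : Subgroup M).index)⁻¹ * y ∈ U := by
  haveI := h.isTopologicalGroup
  haveI := h.compactSpace
  let c : OpenSubgroup M → M := fun U => x ^ E (U : Subgroup M).index
  let t : OpenSubgroup M → Set M := fun U => (fun y => (c U)⁻¹ * y) ⁻¹' (U : Set M)
  have htc : ∀ U, IsClosed (t U) := fun U =>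
    U.isClosed.preimage (continuous_const.mul continuous_id)
  have htn : ∀ U, (t U).Nonempty := fun U =>
    ⟨c U, show (c U)⁻¹ * c U ∈ (U : Set M) by rw [inv_mul_cancel]; exact U.one_mem⟩
  have hmono : ∀ U W : OpenSubgroup M, W ≤ U → t W ⊆ t U := by
    intro U W hWU y hy
    have h1 : (c U)⁻¹ * c W ∈ U := by
      rw [← OpenSubgroup.mem_toSubgroup, ← QuotientGroup.eq]
      exact mk_pow_eq_mk_pow_of_modEq U x (hE _ _ (h.index_ne_zero U) (h.index_ne_zero W)
        (Subgroup.index_dvd_of_le hWU)).symm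
    have h2 : (c W)⁻¹ * y ∈ U := hWU hy
    have : (c U)⁻¹ * y = ((c U)⁻¹ * c W) * ((c W)⁻¹ * y) := by group
    show (c U)⁻¹ * y ∈ (U : Set M)
    rw [this]
    exact U.mul_mem h1 h2
  have htd : Directed (· ⊇ ·) t := fun U W =>
    ⟨U ⊓ W, hmono U (U ⊓ W) inf_le_left, hmono W (U ⊓ W) inf_le_right⟩
  obtain ⟨y, hy⟩ := IsCompact.nonempty_iInter_of_directed_nonempty_isCompact_isClosed t htd htn
    (fun U => (htc U).isCompact) htc
  exact ⟨y, fun U => Set.mem_iInter.mp hy U⟩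

/-- **Compatible profinite powers, functorial form.**  For a compatible system of exponents `E`
(cf. `exists_compatible_elem`) the assignment `x ↦ x ^ E` is a continuous endomorphism of the
profinite abelian group `M`, characterised by `x ^ E ≡ x ^ E([M:U]) (mod U)` for all open `U`.
[cite: MochizukiFrdI2008, Def. 2.8(iii) p.52] -/
theorem exists_compatible_hom (h : IsTfgProfinite M) {E : ℕ → ℕ}
    (hE : ∀ n m : ℕ, n ≠ 0 → m ≠ 0 → n ∣ m → E m ≡ E n [MOD n]) :
    ∃ f : M →* M, Continuous f ∧
      ∀ (x : M) (U : OpenSubgroup M), (x ^ E (U : Subgroup M).index)⁻¹ * f x ∈ U := by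
  haveI := h.isTopologicalGroup
  choose g hg using h.exists_compatible_elem hE
  have hmul : ∀ a b, g (a * b) = g a * g b := by
    intro a b
    refine h.eq_of_forall_inv_mul_mem fun U => ?_
    have h1 := hg (a * b) U
    have h2 := hg a U
    have h3 := hg b U
    rw [← OpenSubgroup.mem_toSubgroup, ← QuotientGroup.eq] at h1 h2 h3 ⊢
    rw [← h1, mul_pow, QuotientGroup.mk_mul, QuotientGroup.mk_mul, h2, h3]
  let f : M →* M := MonoidHom.mk' g hmul
  have hf : ∀ u : M, ∀ U : OpenSubgroup M, u ∈ U → f u ∈ U := by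
    intro u U hu
    have := U.mul_mem (U.pow_mem hu (E (U : Subgroup M).index)) (hg u U)
    rwa [mul_inv_cancel_left] at this
  refine ⟨f, continuous_of_continuousAt_one f ?_, fun x U => hg x U⟩
  rw [ContinuousAt, map_one, tendsto_def]
  intro W hW
  obtain ⟨U, hU⟩ := h.exists_openSubgroup_subset hW
  exact Filter.mem_of_superset U.mem_nhds_one fun u hu => hU (hf u U hu)

end IsTfgProfinite

/-! ### Elementary number theory: primary idempotents modulo `n` -/

/-- The prime-to-`l` part and the `l`-part of `n` are coprime. [cite: MochizukiFrdI2008, Def. 2.8(ii) p.52] -/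
theorem coprime_ordProj_ordCompl {l : ℕ} (hl : l.Prime) (n : ℕ) :
    Nat.Coprime (ordProj[l] n) (ordCompl[l] n) := by
  rcases eq_or_ne n 0 with rfl | hn
  · simp
  · exact (Nat.coprime_ordCompl hl hn).pow_left _

/-- Existence of the `l`-primary idempotent modulo `n`: `e ≡ 1 (mod l^{v_l(n)})`,
`e ≡ 0 (mod n / l^{v_l(n)})`. [cite: MochizukiFrdI2008, Def. 2.8(ii) p.52] -/
theorem exists_primary_idempotent {l : ℕ} (hl : l.Prime) (n : ℕ) :
    ∃ e : ℕ, e ≡ 1 [MOD ordProj[l] n] ∧ e ≡ 0 [MOD ordCompl[l] n] :=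
  let k := Nat.chineseRemainder (coprime_ordProj_ordCompl hl n) 1 0
  ⟨k, k.2⟩

/-- Primary idempotents are compatible: if `n ∣ m` then the `l`-primary idempotent modulo `m`
reduces to the one modulo `n`. [cite: MochizukiFrdI2008, Def. 2.8(ii) p.52] -/
theorem primary_idempotent_modEq {l n m e e' : ℕ} (hm : m ≠ 0) (hnm : n ∣ m)
    (he : e ≡ 1 [MOD ordProj[l] n] ∧ e ≡ 0 [MOD ordCompl[l] n])
    (he' : e' ≡ 1 [MOD ordProj[l] m] ∧ e' ≡ 0 [MOD ordCompl[l] m]) (hl : l.Prime) :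
    e' ≡ e [MOD n] := by
  have h1 : e' ≡ e [MOD ordProj[l] n] :=
    (he'.1.of_dvd (Nat.ordProj_dvd_ordProj_of_dvd hm hnm l)).trans he.1.symm
  have h2 : e' ≡ e [MOD ordCompl[l] n] :=
    (he'.2.of_dvd (Nat.ordCompl_dvd_ordCompl_of_dvd hnm l)).trans he.2.symm
  have := (Nat.modEq_and_modEq_iff_modEq_mul (coprime_ordProj_ordCompl hl n)).mp ⟨h1, h2⟩
  rwa [Nat.ordProj_mul_ordCompl_eq_self] at this

/-- For distinct primes `p ≠ l`, the `p`-part of `n` divides the prime-to-`l` part of `n`.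
[cite: MochizukiFrdI2008, Def. 2.8(ii) p.52] -/
theorem ordProj_dvd_ordCompl_of_ne {p l n : ℕ} (hp : p.Prime) (hpl : p ≠ l) (hn : n ≠ 0) :
    ordProj[p] n ∣ ordCompl[l] n := by
  rw [hp.pow_dvd_iff_le_factorization (Nat.ordCompl_pos l hn).ne', Nat.factorization_ordCompl,
    Finsupp.erase_ne hpl]

/-- A congruence holds modulo `n ≠ 0` as soon as it holds modulo every prime-power part of `n`.
[cite: MochizukiFrdI2008, Def. 2.8(ii) p.52] -/
theorem modEq_of_forall_prime {n a b : ℕ} (hn : n ≠ 0)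
    (h : ∀ p : ℕ, p.Prime → a ≡ b [MOD ordProj[p] n]) : a ≡ b [MOD n] := by
  rw [Nat.modEq_iff_dvd, Int.natCast_dvd]
  set d := Int.natAbs ((b : ℤ) - a) with hd
  rcases eq_or_ne d 0 with hd0 | hd0
  · rw [hd0]; exact dvd_zero _
  refine (Nat.factorization_prime_le_iff_dvd hn hd0).mp fun p hp => ?_
  rw [← hp.pow_dvd_iff_le_factorization hd0]
  have := h p hp
  rw [Nat.modEq_iff_dvd, Int.natCast_dvd] at this
  exact this

/-- **Weighted sums of primary idempotents, locally.**  If `e l` is an `l`-primary idempotent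
modulo `n ≠ 0` for each `l` in a finite set of primes `s ∋ p`, then `∑_{l ∈ s} w l * e l ≡ w p`
modulo the `p`-part of `n`. [cite: MochizukiFrdI2008, Def. 2.8(ii) p.52] -/
theorem sum_mul_primary_idempotent_modEq {n : ℕ} (hn : n ≠ 0) (s : Finset Nat.Primes)
    (e w : Nat.Primes → ℕ)
    (he : ∀ l ∈ s, e l ≡ 1 [MOD ordProj[(l : ℕ)] n] ∧ e l ≡ 0 [MOD ordCompl[(l : ℕ)] n])
    {p : Nat.Primes} (hps : p ∈ s) :
    ∑ l ∈ s, w l * e l ≡ w p [MOD ordProj[(p : ℕ)] n] := by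
  rw [← Finset.add_sum_erase s _ hps]
  have hrest : ordProj[(p : ℕ)] n ∣ ∑ l ∈ s.erase p, w l * e l := by
    refine Finset.dvd_sum fun l hl => Dvd.dvd.mul_left ?_ _
    have hne : (p : ℕ) ≠ (l : ℕ) := fun h => (Finset.ne_of_mem_erase hl) (Subtype.ext h.symm)
    exact (ordProj_dvd_ordCompl_of_ne p.2 hne hn).trans
      (Nat.modEq_zero_iff_dvd.mp (he l (Finset.mem_of_mem_erase hl)).2)
  simpa using (((he _ hps).1).mul_left (w p)).add (Nat.modEq_zero_iff_dvd.mpr hrest)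

/-- **The primary idempotents sum to one.**  If `s` is a finite set of primes containing every prime
factor of `n ≠ 0` and `e l` is an `l`-primary idempotent modulo `n` for each `l ∈ s`, then
`∑_{l ∈ s} e l ≡ 1 (mod n)`. [cite: MochizukiFrdI2008, Def. 2.8(ii) p.52] -/
theorem sum_primary_idempotent_modEq_one {n : ℕ} (hn : n ≠ 0) (s : Finset Nat.Primes)
    (hs : ∀ p : ℕ, p.Prime → p ∣ n → ∃ hp : p.Prime, (⟨p, hp⟩ : Nat.Primes) ∈ s)
    (e : Nat.Primes → ℕ)
    (he : ∀ l ∈ s, e l ≡ 1 [MOD ordProj[(l : ℕ)] n] ∧ e l ≡ 0 [MOD ordCompl[(l : ℕ)] n]) :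
    ∑ l ∈ s, e l ≡ 1 [MOD n] := by
  refine modEq_of_forall_prime hn fun p hp => ?_
  by_cases hpn : p ∣ n
  · obtain ⟨hp', hps⟩ := hs p hp hpn
    simpa using sum_mul_primary_idempotent_modEq hn s e (fun _ => 1) he hps
  · rw [Nat.factorization_eq_zero_of_not_dvd hpn, pow_zero]
    exact Nat.modEq_one

/-- **Chinese remainder with prime-power moduli.**  For any weights `w` there is `z : ℕ` with
`z ≡ w p (mod p^{v_p(n)})` for every prime `p` (the exponent of "raising to the `ζ`-th power"
modulo `n`, Def. 2.8 (iii)). [cite: MochizukiFrdI2008, Def. 2.8(iii) p.52] -/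
theorem exists_modEq_forall_prime (n : ℕ) (w : Nat.Primes → ℕ) :
    ∃ z : ℕ, ∀ p : Nat.Primes, z ≡ w p [MOD ordProj[(p : ℕ)] n] := by
  classical
  rcases eq_or_ne n 0 with rfl | hn
  · exact ⟨0, fun p => by rw [Nat.factorization_zero, Finsupp.zero_apply, pow_zero]; exact Nat.modEq_one⟩
  choose e he using fun l : Nat.Primes => exists_primary_idempotent l.2 n
  refine ⟨∑ l ∈ (n.primeFactors).subtype Nat.Prime, w l * e l, fun p => ?_⟩
  by_cases hpn : (p : ℕ) ∣ n
  · exact sum_mul_primary_idempotent_modEq hn _ e w (fun l _ => he l)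
      (Finset.mem_subtype.mpr (Nat.mem_primeFactors.mpr ⟨p.2, hpn, hn⟩))
  · rw [Nat.factorization_eq_zero_of_not_dvd hpn, pow_zero]
    exact Nat.modEq_one

end Toolkit

/-- **Def. 2.8 (i), "[uniquely determined]" — proved for abelian `M`.**  Two topologies on a
commutative group both making it a topologically finitely generated profinite group coincide:
both have the finite-index subgroups as a neighbourhood basis of `1`
(`IsTfgProfinite.mem_nhds_one_iff`), and a group topology is determined by its neighbourhood
filter at `1`.  (For non-abelian `M` the statement is the Nikolov–Segal theorem, not proved here.)
[cite: MochizukiFrdI2008, Def. 2.8(i) p.52] -/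
theorem TfgProfiniteTopologyUnique.of_commGroup (M : Type u) [CommGroup M] :
    TfgProfiniteTopologyUnique M := by
  intro t₁ t₂ h₁ h₂
  have e₁ := @IsTfgProfinite.mem_nhds_one_iff M _ t₁ h₁
  have e₂ := @IsTfgProfinite.mem_nhds_one_iff M _ t₂ h₂
  exact IsTopologicalGroup.ext (@IsTfgProfinite.isTopologicalGroup M _ t₁ h₁)
    (@IsTfgProfinite.isTopologicalGroup M _ t₂ h₂) (Filter.ext fun W => (e₁ W).trans (e₂ W).symm)

section AbelianScope

variable (M : Type u) [CommGroup M]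

/-- **Def. 2.8 (i), "[uniquely determined]", in the printed (abelian) scope — discharged**: two
topologically-finitely-generated profinite group topologies on a commutative group coincide
(`TfgProfiniteTopologyUnique.of_commGroup`). [cite: MochizukiFrdI2008, Def. 2.8(i) p.52] -/
theorem TfgProfiniteAbelianTopologyUnique_holds : TfgProfiniteAbelianTopologyUnique M :=
  TfgProfiniteTopologyUnique.of_commGroup M

end AbelianScope

end Literature.AlgebraicGeometry.Frobenioids
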